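import Literature.Analysis.InnerProduct.HigherLensSpaceMultiplicityInvariance
import HarnessLib

/-!
# Ikeda's isometry criterion for lens spaces is an equivalence relation on weights prime to `q` (Ikeda 1980, Theorem 2.1)

Layer `Literature/Analysis/InnerProduct`, namespace `Literature.Analysis.InnerProduct`; lane `lit-hodgefound`, prover seat
`lit-hodgefound-p06`, generation 45, row g45-#8. THEOREMS only (no definition, no instance, no notation, no named fact).

## Source, verbatim (held text `paper:doi-10-24033-asens-1384`)

A. Ikeda, *On lens spaces which are isospectral but not isometric*, Ann. Sci. ÉNS (4) 13 (1980) 303–315, §2, Theorem 2.1: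
"Let `L = L(q : p₁, …, p_n)` and `L' = L(q : s₁, …, s_n)` be lens spaces. Then the following assertions are equivalent:
(1) `L` is isometric to `L'`; … (4) There are a number `l`, numbers `e_i ∈ {−1, 1}` and a permutation `σ` such that
`p_{σ(i)} ≡ e_i l s_i (mod q)` for `i = 1, …, n`." The tree's `LensWeightsEquivalent q p s` is assertion (4)
(`HigherLensSpaceMultiplicity.lean`). Since (1) is an equivalence relation on lens spaces — i.e. on weight vectors
`p : Fin n → ℤ` with `(p_i, q) = 1` — so is (4); this file records the direct verification from (4): reflexivity
(`l = 1`, `e_i = 1`, `σ = id`), transitivity (compose the permutations, multiply the `l`'s and the signs), and symmetry for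
weights prime to `q` (then `l` is prime to `q`, and `s_{σ⁻¹(i)} ≡ e_{σ⁻¹(i)} l* p_i` with `ll* ≡ 1`), together with the
elementary closure properties used throughout §4–§8 of Ikeda–Yamamoto 1979 (Proposition 1.1 there): permuting the weights,
changing their signs, and multiplying all of them by a number prime to `q` give equivalent weights.

## References

* [Ikeda1980] A. Ikeda, *On lens spaces which are isospectral but not isometric*, Ann. Sci. ÉNS (4) 13 (1980) 303–315,
  Theorem 2.1.
* [IkedaYamamoto1979] A. Ikeda, Y. Yamamoto, *On the spectra of 3-dimensional lens spaces*, Osaka J. Math. 16 (1979)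
  447–469, Proposition 1.1.
-/

namespace Literature.Analysis.InnerProduct

/-- **Reflexivity of Ikeda's criterion (4)**: `l = 1`, `e_i = 1`, `σ = id`. [cite: Ikeda1980, Theorem 2.1] -/
theorem LensWeightsEquivalent.refl {n : ℕ} (q : ℕ) (p : Fin n → ℤ) : LensWeightsEquivalent q p p :=
  ⟨1, fun _ ↦ 1, fun _ ↦ Or.inl rfl, Equiv.refl _, fun i ↦ by simp⟩

/-- **Transitivity of Ikeda's criterion (4)**: if `p_{σ(i)} ≡ e_i l s_i` and `s_{τ(j)} ≡ f_j l' t_j` then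
`p_{σ(τ(j))} ≡ (e_{τ(j)}f_j)(ll') t_j`. [cite: Ikeda1980, Theorem 2.1] -/
theorem LensWeightsEquivalent.trans {n : ℕ} {q : ℕ} {p s t : Fin n → ℤ} (h₁ : LensWeightsEquivalent q p s)
    (h₂ : LensWeightsEquivalent q s t) : LensWeightsEquivalent q p t := by
  obtain ⟨l, e, he, σ, h⟩ := h₁
  obtain ⟨l', f, hf, τ, h'⟩ := h₂
  refine ⟨l * l', fun j ↦ e (τ j) * f j, fun j ↦ ?_, τ.trans σ, fun j ↦ ?_⟩
  · rcases he (τ j) with h1 | h1 <;> rcases hf j with h2 | h2 <;> simp [h1, h2]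
  · rw [Equiv.trans_apply]
    calc p (σ (τ j)) ≡ e (τ j) * l * s (τ j) [ZMOD q] := h (τ j)
      _ ≡ e (τ j) * l * (f j * l' * t j) [ZMOD q] := (h' j).mul_left _
      _ = e (τ j) * f j * (l * l') * t j := by ring

/-- **Symmetry of Ikeda's criterion (4) for weights prime to `q`**: if `p_{σ(i)} ≡ e_i l s_i (mod q)` for all `i` and the
`p_i` are prime to `q`, then `l` is prime to `q` (unless `n = 0`), and with `ll* ≡ 1`: `s_{σ⁻¹(i)} ≡ e_{σ⁻¹(i)} l* p_i`.
[cite: Ikeda1980, Theorem 2.1] -/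
theorem LensWeightsEquivalent.symm {n : ℕ} {q : ℕ} {p s : Fin n → ℤ} (h : LensWeightsEquivalent q p s)
    (hp : ∀ i, IsCoprime (p i) q) : LensWeightsEquivalent q s p := by
  obtain ⟨l, e, he, σ, h⟩ := h
  rcases Nat.eq_zero_or_pos n with hn | hn
  · subst hn
    exact ⟨1, fun _ ↦ 1, fun i ↦ i.elim0, Equiv.refl _, fun i ↦ i.elim0⟩
  -- `l` is prime to `q`
  have hl : IsCoprime l q := by
    set i₀ : Fin n := ⟨0, hn⟩
    obtain ⟨a, b, hab⟩ := hp (σ i₀)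
    obtain ⟨k, hk⟩ := (h i₀).symm.dvd
    exact ⟨a * e i₀ * s i₀, a * k + b, by linear_combination hab - a * hk⟩
  obtain ⟨u, v, huv⟩ := hl
  refine ⟨u, fun i ↦ e (σ.symm i), fun i ↦ he _, σ.symm, fun i ↦ ?_⟩
  have hi := h (σ.symm i)
  rw [Equiv.apply_symm_apply] at hi
  have he2 : e (σ.symm i) * e (σ.symm i) = 1 := by
    rcases he (σ.symm i) with h1 | h1 <;> simp [h1]
  -- `s_{σ⁻¹ i} = (e·e) (u l + v q) s_{σ⁻¹ i} ≡ e u (e l s_{σ⁻¹ i}) ≡ e u p_i`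
  have h1 : s (σ.symm i) = e (σ.symm i) * u * (e (σ.symm i) * l * s (σ.symm i)) + q * (v * s (σ.symm i)) := by
    linear_combination (-(u * l * s (σ.symm i))) * he2 - s (σ.symm i) * huv
  calc s (σ.symm i) = e (σ.symm i) * u * (e (σ.symm i) * l * s (σ.symm i)) + q * (v * s (σ.symm i)) := h1
    _ ≡ e (σ.symm i) * u * (e (σ.symm i) * l * s (σ.symm i)) + 0 [ZMOD q] :=
        Int.ModEq.add_left _ (Int.modEq_zero_iff_dvd.mpr (dvd_mul_right _ _))
    _ ≡ e (σ.symm i) * u * p i + 0 [ZMOD q] := ((hi.symm.mul_left _).add_right _)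
    _ = e (σ.symm i) * u * p i := add_zero _

/-- For weights prime to `q` on both sides the criterion is symmetric. [cite: Ikeda1980, Theorem 2.1] -/
theorem lensWeightsEquivalent_comm {n : ℕ} {q : ℕ} {p s : Fin n → ℤ} (hp : ∀ i, IsCoprime (p i) q)
    (hs : ∀ i, IsCoprime (s i) q) : LensWeightsEquivalent q p s ↔ LensWeightsEquivalent q s p :=
  ⟨fun h ↦ h.symm hp, fun h ↦ h.symm hs⟩

/-- **Permuting the weights** gives equivalent weights (`l = 1`, `e_i = 1`): `L(q : p_{τ(1)}, …, p_{τ(n)}) ≅ L(q : p₁, …, p_n)`.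
[cite: Ikeda1980, Theorem 2.1] [cite: IkedaYamamoto1979, Proposition 1.1] -/
theorem lensWeightsEquivalent_comp_perm {n : ℕ} (q : ℕ) (p : Fin n → ℤ) (τ : Equiv.Perm (Fin n)) :
    LensWeightsEquivalent q (p ∘ τ) p :=
  ⟨1, fun _ ↦ 1, fun _ ↦ Or.inl rfl, τ.symm, fun i ↦ by simp⟩

/-- **Changing the signs of the weights** gives equivalent weights (`l = 1`, `σ = id`): `L(q : ε₁p₁, …, ε_np_n) ≅ L(q : p₁, …, p_n)`.
[cite: Ikeda1980, Theorem 2.1] [cite: IkedaYamamoto1979, Proposition 1.1] -/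
theorem lensWeightsEquivalent_sign_mul {n : ℕ} (q : ℕ) (p : Fin n → ℤ) {ε : Fin n → ℤ} (hε : ∀ i, ε i = 1 ∨ ε i = -1) :
    LensWeightsEquivalent q (fun i ↦ ε i * p i) p :=
  ⟨1, ε, hε, Equiv.refl _, fun i ↦ by simp⟩

/-- **Multiplying all weights by one number** gives equivalent weights (`e_i = 1`, `σ = id`): `L(q : lp₁, …, lp_n) ≅ L(q : p₁, …, p_n)`
(for `l` prime to `q` these are again admissible weights). [cite: Ikeda1980, Theorem 2.1] [cite: IkedaYamamoto1979,
Proposition 1.1] -/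
theorem lensWeightsEquivalent_const_mul {n : ℕ} (q : ℕ) (p : Fin n → ℤ) (l : ℤ) :
    LensWeightsEquivalent q (fun i ↦ l * p i) p :=
  ⟨l, fun _ ↦ 1, fun _ ↦ Or.inl rfl, Equiv.refl _, fun i ↦ by simp⟩

/-- **Scaling to the normalized form**: if `up₁ ≡ 1 (mod q)` then `(p_i)_i ~ (up_i)_i`, whose first weight is `≡ 1` — "we may
assume `p₀ = 1`" (§4 of Ikeda–Yamamoto). [cite: IkedaYamamoto1979, Proposition 1.1, §4] [cite: Ikeda1980, Theorem 2.1] -/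
theorem lensWeightsEquivalent_mul_of_mul_modEq_one {n : ℕ} (q : ℕ) (p : Fin n → ℤ) {u l : ℤ} (hul : u * l ≡ 1 [ZMOD q]) :
    LensWeightsEquivalent q p (fun i ↦ u * p i) :=
  ⟨l, fun _ ↦ 1, fun _ ↦ Or.inl rfl, Equiv.refl _, fun i ↦ by
    calc p i = 1 * p i := (one_mul _).symm
      _ ≡ (u * l) * p i [ZMOD q] := hul.symm.mul_right _
      _ = 1 * l * (u * p i) := by ring⟩

end Literature.Analysis.InnerProduct
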